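import Summits.QuantumFields.YangMills.Theorems.BalabanUVNodesN12GaugeLetterLocOfClassLam
import Summits.QuantumFields.YangMills.Theorems.BalabanUVNodesN12DatumLetterOfShadows
import HarnessLib

/-!
# BalabanUVNodes ∕ N12 — THE DATUM LETTER OF THE (σ)_N CAPSTONE IS GEOMETRY, AT PRINT's DATUM `Λ(Z) = lamBondsSeq (maxDomT ν.M₁ Z) k` ([Balaban1984PropagatorsII] (2.3)): dag-n12-w3's
# `…N12DatumLetterOfShadows` RE-KEYED — §1 the shadow lemma for ANY bond datum `𝔅` (the parent's proof is per bond), §2 the class capstone of O1 (5) with the datum letter `hWj` on PRINT members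
# replaced by the shadow geometry of PRINT members — O1 module (6) of the gauge-letter chain (dag-n12-d CEDE ∕ dag-lead WORDS 426∕427∕430, pub-ymgap INBOX 2026-08-30)

[Balaban1984PropagatorsII] = «[II]», (2.3) p. 224; [Balaban1988Convergent] = «[III]», (2.16) p. 257, p. 267 L5–7; [Balaban1989LargeFieldI], p. 193 L14–16; [Balaban1987RG1] = «[RG1]», (0.1) p. 251,
(0.4) p. 253; [Balaban1985Variational] = «[15]», (2)–(4) p. 278, (16)–(18) p. 280; [Balaban1985RegularSpaces] = «[6]», (1.7) p. 77, (1.19) p. 79.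

Cell `pub-ymgap` (HUMAN RULINGS D-0062 ∕ D-0149), lane `pub-ymgap-dag-n12-c` g37 (R134 seat (a), N12 = [B15], s1, lane owner); `--kind proof --supports` K1⁹ `stmt-QuantumFields-27364` `--as helper`;
count-neutral.  THEOREMS ONLY (0 `def`, 0 `instance`, 0 `sorry`); the parent's two theorems with their proof texts (tree bytes, `work/gen_shadows_lam.py`) and the substitutions `DetSet 𝔹 ∕
bondsOf (𝔹 i) ↦ BDetSet 𝔅 ∕ 𝔅 i` (§1), `hmin ↦ IsMinimizerB … (lamBondsSeq …)`, `bondsOf (𝐁_k(Z)_i) ↦ Λ_i(Z)` in `ha`∕`hGmem`∕`hu`, Cin on all of `N`, and the supplier `…OfClass ↦ …OfClassLam`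
(§2); by name over `B15Prop1MinimiserTowerAxialGauge.dist1_avgFamily_avOfRecord_qsstarGIter0_le` (per level, datum-free), `B15Prop1DatumSmall7AtZSequence.blockIter_add_embIter`, O1 (5)
`…N12GaugeLetterLocOfClassLam.exists_gaugeLetterLoc_atRecord_lamBondsSeq_of_class`.  DECL MAP (old → new): `N12DatumLetterOfShadows.datumLetter_of_shadows ↦
N12DatumLetterOfShadowsLam.datumLetter_of_shadows_bdet` (generic `𝔅`; the parent is the instance `𝔅 := bondsDet 𝐁`), `….exists_gaugeLetterLoc_atRecord_of_class_of_shadows ↦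
….exists_gaugeLetterLoc_atRecord_lamBondsSeq_of_class_of_shadows`.

HONEST FRAMING.  Composition by name + per-bond bookkeeping; the minimiser ([15] Thm 1 ∕ (E)), the region datum, the `N`-geometry, the shadow geometry, the plaquette letter on the iterated
averages and the numerics stay HYPOTHESES; nothing of Bałaban's asserted or refuted; count-neutral helper (`--supports 27364`); N12 NOT discharged; K0⁷∕K1⁹ NOT closed; counts of record unmoved
(typed 28∕28 · discharged 8∕27); one finite 𝕋⁴ programme at fixed ε — R4 closes the conditional rung `BalabanLadder.UV` only; the Yang–Mills mass gap (Clay) is NOT proved by any of this;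
nothing continuum ∕ ℝ⁴ ∕ OS.
-/

noncomputable section

open scoped Matrix.Norms.L2Operator BigOperators

namespace Summit.QuantumFields.YangMills.BalabanUVNodes.N12DatumLetterOfShadowsLam

open Literature.MathematicalPhysics.QuantumFieldTheory.Balaban1983to89
open T4Continuum GaugeField B15DeterminingSets B15DeterminingSetsB BlockAveraging
open T4CubeChartGnomonic (SU2)
open B16Sect1Backgrounds (toMS)
open T4AxialGaugeSmallField (boxPlaqs)
open B14.Eq213MaximalDomains (side)
open B14.Eq213DetSet (Bj maxDomT)
open B14.Eq22Determines (blockIter)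
open B5Eq118OneStroke (iterBlockOf)
open B8Eq17ClassAkV1 (plaqsOf)
open ExpMeanLog (deltaSU)
open Literature.MathematicalPhysics.QuantumFieldTheory.BalabanImbrieJaffe1984to88.BIJ85Eq453GaugeField (qsstarGIter0)
open B15Prop1MinimiserTowerAxialGauge (dist1_avgFamily_avOfRecord_qsstarGIter0_le)
open B15Prop1DatumSmall7AtZSequence (blockIter_add_embIter)
open Summit.QuantumFields.YangMills.BalabanUVNodes.N12GaugeLetterLocOfClassLam (exists_gaugeLetterLoc_atRecord_lamBondsSeq_of_class)

/-! ## §1 The datum letter from the shadow geometry, any bond datum -/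

/-- ★★ **[BOND-DATUM EDITION: any `𝔅 : BDetSet`, e.g. print's `lamBondsSeq (maxDomT ν.M₁ Z) k`; the parent's proof is per bond.]** **THE DATUM LETTER FROM THE SHADOWS.**  Torus `F.P Kt`, group `SU(N)`, averaging of record, `k ≤ m + K`, any bond determining datum `𝔅`, a `k`-field `W` that is `ρn`-near `1` on a bond set `𝒞`
(`0 ≤ ρn`).  If the `k`-SHADOW `⟨B^k(ι_i c₋), μ(c)⟩` of every member bond `c ∈ 𝔅 i` (`i ≤ k`) whose ends have different `k`-blocks lies in `𝒞`, then the level-`i` entry of the data `M˙(Q_k^{s*}W)`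
at every member bond is `ρn`-near `1` — the letter `hWj` of the (σ)_N capstones with `δ₁ := ρn`.  (p622221 §5 per level; the index bridge `B^{i+n}(ι_i y) = B^n(y)`.)
[cite: Balaban1988Convergent, (2.16) p.257, p.267 L5–7; Balaban1989LargeFieldI, p.193 L14–16; Balaban1987RG1, (0.1) p.251, (0.4) p.253] -/
theorem datumLetter_of_shadows_bdet {F : T4Family} {N : ℕ} [NeZero N] (Kt : ℕ) {k : ℕ} (hk : k ≤ (F.P Kt).m + (F.P Kt).K) (𝔅 : BDetSet (F.P Kt))
    (W : GaugeField (F.P Kt) k (Node00.SU N)) {𝒞 : Set (PBond (F.P Kt) k)} {ρn : ℝ} (hρn : 0 ≤ ρn) (hD : ∀ c ∈ 𝒞, dist1 (W c) ≤ ρn)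
    (hGmem : ∀ i ≤ k, ∀ c ∈ 𝔅 i, blockIter k (embIter i c.tgt) ≠ blockIter k (embIter i c.src) →
      (⟨blockIter k (embIter i c.src), c.dir⟩ : PBond (F.P Kt) k) ∈ 𝒞) :
    ∀ i ≤ k, ∀ c ∈ 𝔅 i, dist1 (avgFamily (Node00.avOfRecord F N Kt) (qsstarGIter0 k W) i c) ≤ ρn := by
  intro i hi c hc
  obtain ⟨n, rfl⟩ := Nat.exists_eq_add_of_le hi
  have hG := hGmem i hi c hc
  rw [blockIter_add_embIter i n hk c.tgt, blockIter_add_embIter i n hk c.src] at hG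
  exact dist1_avgFamily_avOfRecord_qsstarGIter0_le Kt hk W hρn c fun hne => hD _ (hG hne)

/-! ## §2 The class capstone at print's datum with the datum letter replaced by the shadow geometry -/

/-- ★★★ **[PRINT's DATUM `Λ(Z)`: `hmin ↦ IsMinimizerB … (lamBondsSeq …)`, `ha`∕`hGmem`∕`hu` on print members, Cin on all of `N`; over O1 (5).]** **(σ)_N AT THE RECORD FROM THE CLASS AND THE SHADOW GEOMETRY.**  As `N12GaugeLetterLocOfClassLam.exists_gaugeLetterLoc_atRecord_lamBondsSeq_of_class`, with the datum letter `hWj` replaced by the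
geometry letter «the `k`-shadows of the face-crossing members of `𝐁_k(Z)` lie in `𝒞`» (`δ₁ := ρn`).  RESIDUE: the minimiser in NODE 00's class, the region datum `W 𝒞 ρn`, the `N`-geometry, the
shadow geometry, the plaquette letter `a_j`∕`θ` on the iterated averages near member segments, no wrapping, the radius numerics, `0 ≤ εreg`, `2 ≤ M₁`, cover divisibility.
[cite: Balaban1985Variational, (2)–(4) p.278, (16)–(18) p.280; Balaban1985RegularSpaces, (1.7) p.77, (1.19) p.79; Balaban1988Convergent, (2.12)–(2.13) pp.256–257, (2.16) p.257, p.267; Balaban1987RG1, (0.4) p.253] -/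
theorem exists_gaugeLetterLoc_atRecord_lamBondsSeq_of_class_of_shadows {F : T4Family} (ν : Node00.Stage7Numerics) (Kt : ℕ) {k : ℕ} (hk0 : 0 < k) (hk : k ≤ (F.P Kt).m + (F.P Kt).K)
    (hM2 : 2 ≤ ν.M₁) (hdiv : side (F.P Kt).L ν.M₁ k ∣ (F.P Kt).sitesPerDir 0) (Z : Set (Site (F.P Kt) 0)) (hεreg : 0 ≤ ν.εreg)
    -- no wrapping, at the caps `ℓ_k`, `m·L^k`
    (hN : 2 * (∑ i ∈ Finset.range (k + 1), ((F.P Kt).d * (((F.P Kt).L ^ i - 1) / 2) + 1)) + 1 +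
      (3 * ((F.P Kt).d * (((F.P Kt).L - 1) / 2)) + 5) * (F.P Kt).L ^ k < (F.P Kt).sitesPerDir 0)
    -- radius numerics: the level-`J` box fits the collar `L^{J−1}·M₁`
    (hRad : ∀ J, 1 ≤ J → J ≤ k →
      (2 * ∑ i ∈ Finset.range (J + 1 + 1), ((F.P Kt).d * (((F.P Kt).L ^ i - 1) / 2) + 1)) + 1 +
          (3 * ((F.P Kt).d * (((F.P Kt).L - 1) / 2)) + 5) * (F.P Kt).L ^ min (J + 1) k +
        (∑ i ∈ Finset.range (J + 1), ((F.P Kt).d * (((F.P Kt).L ^ i - 1) / 2) + 1)) + 3 ≤ (F.P Kt).L ^ (J - 1) * ν.M₁)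
    -- the region-normalised datum and the minimiser
    {ρn : ℝ} (hρn : 0 ≤ ρn)
    (W : GaugeField (F.P Kt) k SU2) (𝒞 : Set (PBond (F.P Kt) k)) (hD : ∀ c ∈ 𝒞, dist1 (W c) ≤ ρn)
    {U₀ : GaugeField (F.P Kt) 0 SU2}
    (hmin : IsMinimizerB (Node00.avOfRecord F 2 Kt) (Node00.regMSCoPOfRecord F 2 ν Kt k (maxDomT ν.M₁ Z)) (lamBondsSeq (maxDomT ν.M₁ Z) k)
      (avgFamily (Node00.avOfRecord F 2 Kt) (qsstarGIter0 k W)) U₀)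
    -- geometry of the neighbourhood (dag-n12-w6's letters, verbatim)
    (N : Set (PBond (F.P Kt) 0))
    (hGN : ∀ b ∈ N, (b.src ∉ maxDomT ν.M₁ Z 1 ∨ b.tgt ∉ maxDomT ν.M₁ Z 1) → blockIter k b.tgt ≠ blockIter k b.src →
      (⟨blockIter k b.src, b.dir⟩ : PBond (F.P Kt) k) ∈ 𝒞)
    (hN1 : ∀ p : Plaq (F.P Kt) 0, ((⟨p.src, p.μ⟩ : PBond (F.P Kt) 0) ∈ {b : PBond (F.P Kt) 0 | b.src ∈ maxDomT ν.M₁ Z 1} ∨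
        (⟨p.src.shift p.μ, p.ν⟩ : PBond (F.P Kt) 0) ∈ {b : PBond (F.P Kt) 0 | b.src ∈ maxDomT ν.M₁ Z 1} ∨
        (⟨p.src.shift p.ν, p.μ⟩ : PBond (F.P Kt) 0) ∈ {b : PBond (F.P Kt) 0 | b.src ∈ maxDomT ν.M₁ Z 1} ∨
        (⟨p.src, p.ν⟩ : PBond (F.P Kt) 0) ∈ {b : PBond (F.P Kt) 0 | b.src ∈ maxDomT ν.M₁ Z 1}) →
      (⟨p.src, p.μ⟩ : PBond (F.P Kt) 0) ∈ N ∧ (⟨p.src.shift p.μ, p.ν⟩ : PBond (F.P Kt) 0) ∈ N ∧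
        (⟨p.src.shift p.ν, p.μ⟩ : PBond (F.P Kt) 0) ∈ N ∧ (⟨p.src, p.ν⟩ : PBond (F.P Kt) 0) ∈ N)
    -- DISPLAYED: the plaquette letter on the iterated averages near the member segments, with its budgets
    (a θ : ℕ → ℝ) (hθ0 : 0 ≤ θ 0) (ha0 : ∀ j, 0 ≤ a j)
    (haN : ∀ j < k, (((((F.P Kt).d + 2) * (F.P Kt).L : ℕ) : ℝ) ^ 2 / 4) * a j < deltaSU (Fin 2))
    (hθ : ∀ j, 6 * ((((((F.P Kt).d + 2) * (F.P Kt).L : ℕ) : ℝ) ^ 2 / 4) * a j) + (F.P Kt).L * θ j ≤ θ (j + 1))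
    (ha : ∀ i ≤ k, ∀ c ∈ lamBondsSeq (maxDomT ν.M₁ Z) k i, ∀ j < i, ∀ c' : PBond (F.P Kt) (j + 1), c'.dir = c.dir →
      (∃ s < (F.P Kt).L ^ i, embIter (j + 1) c'.src = (fun z : Site (F.P Kt) 0 => z.shift c.dir)^[s] (embIter i c.src)) →
      ∀ q : Plaq (F.P Kt) j, (blockOf q.src = c'.src.unshift c'.dir ∨ blockOf q.src = c'.src ∨ blockOf q.src = c'.tgt) →
        dist1 (GaugeField.plaqHol (avgFamily (Node00.avOfRecord F 2 Kt) U₀ j) q) < a j)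
    -- GEOMETRY instead of the datum letter: the `k`-shadows of the face-crossing members of `𝐁_k(Z)` lie in `𝒞`
    (hGmem : ∀ i ≤ k, ∀ c ∈ lamBondsSeq (maxDomT ν.M₁ Z) k i, blockIter k (embIter i c.tgt) ≠ blockIter k (embIter i c.src) →
      (⟨blockIter k (embIter i c.src), c.dir⟩ : PBond (F.P Kt) k) ∈ 𝒞) :
    ∃ σ : GaugeTransf (F.P Kt) 0 SU2,
      (∀ j, j ≤ k → ∀ b ∈ lamBondsSeq (maxDomT ν.M₁ Z) k j, toMS σ j b.src = 1 ∧ toMS σ j b.tgt = 1) ∧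
        (∀ p : Plaq (F.P Kt) 0, ((⟨p.src, p.μ⟩ : PBond (F.P Kt) 0) ∈ {b : PBond (F.P Kt) 0 | b.src ∈ maxDomT ν.M₁ Z 1} ∨
            (⟨p.src.shift p.μ, p.ν⟩ : PBond (F.P Kt) 0) ∈ {b : PBond (F.P Kt) 0 | b.src ∈ maxDomT ν.M₁ Z 1} ∨
            (⟨p.src.shift p.ν, p.μ⟩ : PBond (F.P Kt) 0) ∈ {b : PBond (F.P Kt) 0 | b.src ∈ maxDomT ν.M₁ Z 1} ∨
            (⟨p.src, p.ν⟩ : PBond (F.P Kt) 0) ∈ {b : PBond (F.P Kt) 0 | b.src ∈ maxDomT ν.M₁ Z 1}) →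
          ‖((gaugeAct σ U₀ ⟨p.src, p.μ⟩ : SU2) : Matrix (Fin 2) (Fin 2) ℂ) - 1‖ ≤
              max ρn ((((2 * (∑ i ∈ Finset.range (k + 1), ((F.P Kt).d * (((F.P Kt).L ^ i - 1) / 2) + 1)) + 1 +
                  (3 * ((F.P Kt).d * (((F.P Kt).L - 1) / 2)) + 5) * (F.P Kt).L ^ k : ℕ) : ℝ)) ^ 2 / 4 * (ν.εreg * (F.P Kt).eta 0 ^ 2) +
                ((3 * ((F.P Kt).d * (((F.P Kt).L - 1) / 2)) + 5 : ℕ) : ℝ) * θ k + ((3 * ((F.P Kt).d * (((F.P Kt).L - 1) / 2)) + 5 : ℕ) : ℝ) * ρn) ∧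
            ‖((gaugeAct σ U₀ ⟨p.src.shift p.μ, p.ν⟩ : SU2) : Matrix (Fin 2) (Fin 2) ℂ) - 1‖ ≤
              max ρn ((((2 * (∑ i ∈ Finset.range (k + 1), ((F.P Kt).d * (((F.P Kt).L ^ i - 1) / 2) + 1)) + 1 +
                  (3 * ((F.P Kt).d * (((F.P Kt).L - 1) / 2)) + 5) * (F.P Kt).L ^ k : ℕ) : ℝ)) ^ 2 / 4 * (ν.εreg * (F.P Kt).eta 0 ^ 2) +
                ((3 * ((F.P Kt).d * (((F.P Kt).L - 1) / 2)) + 5 : ℕ) : ℝ) * θ k + ((3 * ((F.P Kt).d * (((F.P Kt).L - 1) / 2)) + 5 : ℕ) : ℝ) * ρn) ∧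
            ‖((gaugeAct σ U₀ ⟨p.src.shift p.ν, p.μ⟩ : SU2) : Matrix (Fin 2) (Fin 2) ℂ) - 1‖ ≤
              max ρn ((((2 * (∑ i ∈ Finset.range (k + 1), ((F.P Kt).d * (((F.P Kt).L ^ i - 1) / 2) + 1)) + 1 +
                  (3 * ((F.P Kt).d * (((F.P Kt).L - 1) / 2)) + 5) * (F.P Kt).L ^ k : ℕ) : ℝ)) ^ 2 / 4 * (ν.εreg * (F.P Kt).eta 0 ^ 2) +
                ((3 * ((F.P Kt).d * (((F.P Kt).L - 1) / 2)) + 5 : ℕ) : ℝ) * θ k + ((3 * ((F.P Kt).d * (((F.P Kt).L - 1) / 2)) + 5 : ℕ) : ℝ) * ρn) ∧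
            ‖((gaugeAct σ U₀ ⟨p.src, p.ν⟩ : SU2) : Matrix (Fin 2) (Fin 2) ℂ) - 1‖ ≤
              max ρn ((((2 * (∑ i ∈ Finset.range (k + 1), ((F.P Kt).d * (((F.P Kt).L ^ i - 1) / 2) + 1)) + 1 +
                  (3 * ((F.P Kt).d * (((F.P Kt).L - 1) / 2)) + 5) * (F.P Kt).L ^ k : ℕ) : ℝ)) ^ 2 / 4 * (ν.εreg * (F.P Kt).eta 0 ^ 2) +
                ((3 * ((F.P Kt).d * (((F.P Kt).L - 1) / 2)) + 5 : ℕ) : ℝ) * θ k + ((3 * ((F.P Kt).d * (((F.P Kt).L - 1) / 2)) + 5 : ℕ) : ℝ) * ρn)) ∧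
        (∀ b ∈ N,
          ‖((gaugeAct σ U₀ b : SU2) : Matrix (Fin 2) (Fin 2) ℂ) - 1‖ ≤
              max ρn ((((2 * (∑ i ∈ Finset.range (k + 1), ((F.P Kt).d * (((F.P Kt).L ^ i - 1) / 2) + 1)) + 1 +
                  (3 * ((F.P Kt).d * (((F.P Kt).L - 1) / 2)) + 5) * (F.P Kt).L ^ k : ℕ) : ℝ)) ^ 2 / 4 * (ν.εreg * (F.P Kt).eta 0 ^ 2) +
                ((3 * ((F.P Kt).d * (((F.P Kt).L - 1) / 2)) + 5 : ℕ) : ℝ) * θ k + ((3 * ((F.P Kt).d * (((F.P Kt).L - 1) / 2)) + 5 : ℕ) : ℝ) * ρn)) :=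
  exists_gaugeLetterLoc_atRecord_lamBondsSeq_of_class ν Kt hk0 hk hM2 hdiv Z hεreg hN hRad hρn W 𝒞 hD hmin N hGN hN1 a θ hθ0 ha0 haN hθ ha hρn
    (datumLetter_of_shadows_bdet Kt hk (lamBondsSeq (maxDomT ν.M₁ Z) k) W hρn hD hGmem)

end Summit.QuantumFields.YangMills.BalabanUVNodes.N12DatumLetterOfShadowsLam

end
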